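import Literature.AlgebraicGeometry.Motives.DeRhamComparisonFrolicherFiniteProofs
import Literature.NumberTheory.Transcendental.ComplexDeRhamHolds
import Literature.NumberTheory.Transcendental.DolbeaultCartanSerreProofs
import HarnessLib

/-!
# The Frölicher inequality from Cartan–Serre finiteness alone

With de Rham's theorem now proved (`finrank_complexDeRham_eq_bettiNumber_holds`), the named fact
`bettiNumber_le_sum_hodgeNumber E M` (`b_k(M) ≤ ∑_{p+q=k} h^{p,q}(M)` for compact complex
manifolds; Voisin (2002), §8.3.3, proof of Thm. 8.28 and Rem. 8.29, pp. 204–205; Frölicher 1955)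
is reduced to exactly ONE remaining input, Cartan–Serre finiteness of Dolbeault cohomology
(`Literature.NumberTheory.Transcendental.finite_dolbeaultCohomology`):

* `bettiNumber_le_sum_hodgeNumber_of_finite_dolbeaultCohomology` —
  `finite_dolbeaultCohomology → bettiNumber_le_sum_hodgeNumber E M`.

Feeding a future `finite_dolbeaultCohomology_holds` to it gives `bettiNumber_le_sum_hodgeNumber_holds`.

## References

* C. Voisin, *Hodge Theory and Complex Algebraic Geometry I*, CUP 2002, §8.3.3, pp. 204–205.
  [VoisinHodgeI2002]
* A. Frölicher, *Relations between the cohomology groups of Dolbeault and topological invariants*,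
  PNAS 41 (1955). [FrolicherPNAS1955]
-/

open scoped Manifold ContDiff
open Literature.NumberTheory.Transcendental

namespace Literature.AlgebraicGeometry.Motives

variable (E : Type) [NormedAddCommGroup E] [NormedSpace ℂ E]
  (M : Type) [TopologicalSpace M] [ChartedSpace E M]
  [IsManifold 𝓘(ℂ, E) ω M] [IsManifold 𝓘(ℝ, E) ∞ M]

/-- **Frölicher inequality from Cartan–Serre finiteness**: for a complex manifold `M` modelled on
`E`, `finite_dolbeaultCohomology → bettiNumber_le_sum_hodgeNumber E M`, i.e. once the Dolbeault
groups of compact `M` are known to be finite-dimensional, `b_k(M; ℂ) ≤ ∑_{p+q=k} h^{p,q}(M)`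
(Voisin (2002), §8.3.3, proof of Thm. 8.28 / Rem. 8.29: the Frölicher spectral sequence gives
`dim H^k_dR(M; ℂ) ≤ ∑ h^{p,q}` — `finrank_complexDeRham_le_sum_hodgeNumber_of_finite` — and
de Rham's theorem `dim_ℂ H^k_dR(M; ℂ) = b_k` — `finrank_complexDeRham_eq_bettiNumber_holds`).
[cite: VoisinHodgeI2002, §8.3.3, proof of Thm. 8.28 and Rem. 8.29, pp. 204–205] -/
theorem bettiNumber_le_sum_hodgeNumber_of_finite_dolbeaultCohomology
    (hCS : finite_dolbeaultCohomology (E := E) (M := M)) :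
    bettiNumber_le_sum_hodgeNumber E M := by
  intro _ _ _ _ _ k
  exact bettiNumber_le_sum_hodgeNumber_of E M
    (finrank_complexDeRham_le_sum_hodgeNumber_of_finite E M hCS)
    (fun k ↦ finrank_complexDeRham_eq_bettiNumber_holds E M k) k

omit [IsManifold 𝓘(ℂ, E) ω M] [IsManifold 𝓘(ℝ, E) ∞ M] in
/-- **The Frölicher inequality `b_k(M) ≤ ∑_{p+q=k} h^{p,q}(M)` for compact complex manifolds**
(discharge of the named fact `bettiNumber_le_sum_hodgeNumber`): Voisin (2002), §8.3.3, proof of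
Thm. 8.28 / Rem. 8.29 (pp. 204–205) — the Frölicher spectral sequence bounds
`dim H^k_dR(M; ℂ)` by `∑_{p+q=k} h^{p,q}(M)` once the Dolbeault groups are finite-dimensional,
which is the Cartan–Serre finiteness theorem (`finite_dolbeaultCohomology_holds`, Cartan–Serre
(1953) in the sup-norm form of Grauert–Remmert (1977), Kap. VI §4), and de Rham's theorem
identifies `dim_ℂ H^k_dR(M; ℂ)` with `b_k(M)`.
[cite: VoisinHodgeI2002, §8.3.3, proof of Thm. 8.28 and Rem. 8.29, pp. 204–205] -/
theorem bettiNumber_le_sum_hodgeNumber_holds : bettiNumber_le_sum_hodgeNumber E M := by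
  intro _ _ _ _ _ k
  exact bettiNumber_le_sum_hodgeNumber_of_finite_dolbeaultCohomology E M finite_dolbeaultCohomology_holds k

end Literature.AlgebraicGeometry.Motives
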